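import Summits.ValiantsHypothesis.ValiantsHypothesis.Theorems.KPlusLogSqLawValuativeDoorTameRoof

/-!
# LINE `valuative_door` (crux `WeakLifting`, stmt-ValiantsHypothesis-19561) — NESTED LEADING PAIRS ARE NEVER BOTH DOMINANT when the
# progression classes are tame (general injective supports)

HONEST FRAMING.  Helper (cell `pub-symmetroid`, seat val-sym-lift-p1 g25, 2026-08-29; `--supports 19561 --as helper`).  Width two, ALL `K`,
every field, every non-archimedean `v`.  `not_nested_leading_of_tame` = ✓ `not_nested_leading_of_apfree` (this seat) with the global
no-3-AP hypothesis replaced by TAMENESS of every progression class `2 d_z = d_x + d_w` (`v(det S_z), v(G_{xw}) ≤ v(f_{2d_z})`): for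
`a < b < c < e` with `B = d_a + d_e`, `C = d_b + d_c` both dominant and `(a,e)`, `(b,c)` leading their classes — contradiction.  The roof
argument is unchanged (✓ `log_polar_le_roof_of_tame`, ✓ `touching_polar_between_of_tame`); the new point: a touching non-reversal Leibniz
term of the `{a,b,c,e}` Gram minor may now use a touching DIAGONAL cell of a middle letter doubled into class `B` (`2 d_b = B` is a
progression) — but a permutation using one middle diagonal cell and the two outer reversal cells must use the other middle diagonal cell
too, and `2 d_b = B = 2 d_c` is absurd.  Consumed by `…TameLaw`.  Nothing here is a stub of the line or closes anything; no bearing on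
vW / vB, `TropicalB`, `MatrixDescartes` (18050) or VP ≠ VNP.  [roof + Gram rank 3]
-/

set_option linter.dupNamespace false
set_option autoImplicit false

namespace Summit.ValiantsHypothesis.ValiantsHypothesis.Theorems.KPlusLogSqLaw.ValDoor

open Polynomial Finset Matrix
open scoped BigOperators Classical

variable {F : Type*} [Field F]

/-! ## §1 Leading pairs are never nested -/

/-- **NESTED LEADING PAIRS ARE NEVER BOTH DOMINANT (tame progression classes, ALL letters).**  For four letters `a < b < c < e`
(strictly increasing exponents, every progression class tame) whose pair classes `B = d_a + d_e ≠ C = d_b + d_c` are both dominant and which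
LEAD their classes (`v(G_{ae}) = v(f_B)`, `v(G_{bc}) = v(f_C)`): contradiction.  g23's roof argument (✓ `not_nested_dominant_of_sidon`)
with the Sidon bookkeeping replaced by the roof-excess lemma (every entry under the roof) and `touching_polar_between` (a tying
non-reversal Leibniz term of the `{a,b,c,e}` Gram minor would need a touching off-diagonal cell with exponent outside
`[min(B,C), max(B,C)]`, or touching diagonal cells at BOTH middle letters (a touching diagonal cell has class `B`, and
`2 d_b = B = 2 d_c` is absurd) — so it is the reversal. [roof + propagation] -/
theorem not_nested_leading_of_tame (v : AbsoluteValue F ℝ) (hv : IsNonarchimedean v) {K : ℕ} (d : Fin K → ℕ)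
    (hd : StrictMono d) (S : Fin K → Matrix (Fin 2) (Fin 2) F) (hS : ∀ l, (S l).IsSymm)
    (hT : ∀ z x w : Fin K, x < w → d x + d w = d z + d z →
      v (S z 0 0 * S z 1 1 - S z 0 1 * S z 0 1)
          ≤ v ((Matrix.det (∑ l, ((X : F[X]) ^ d l) • (S l).map (C : F →+* F[X]))).coeff (d z + d z)) ∧
        v (S x 0 0 * S w 1 1 + S w 0 0 * S x 1 1 - 2 * S x 0 1 * S w 0 1)
          ≤ v ((Matrix.det (∑ l, ((X : F[X]) ^ d l) • (S l).map (C : F →+* F[X]))).coeff (d z + d z)))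
    {a b c e : Fin K} (hab : a < b) (hbc : b < c) (hce : c < e)
    (hB : (d a + d e) ∈ (Matrix.det (∑ l, ((X : F[X]) ^ d l) • (S l).map (C : F →+* F[X]))).support ∧
      ∃ r : ℝ, 0 < r ∧ ∀ E' ∈ (Matrix.det (∑ l, ((X : F[X]) ^ d l) • (S l).map (C : F →+* F[X]))).support, E' ≠ d a + d e →
        v ((Matrix.det (∑ l, ((X : F[X]) ^ d l) • (S l).map (C : F →+* F[X]))).coeff E') * r ^ E'
          < v ((Matrix.det (∑ l, ((X : F[X]) ^ d l) • (S l).map (C : F →+* F[X]))).coeff (d a + d e)) * r ^ (d a + d e))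
    (hC : (d b + d c) ∈ (Matrix.det (∑ l, ((X : F[X]) ^ d l) • (S l).map (C : F →+* F[X]))).support ∧
      ∃ r : ℝ, 0 < r ∧ ∀ E' ∈ (Matrix.det (∑ l, ((X : F[X]) ^ d l) • (S l).map (C : F →+* F[X]))).support, E' ≠ d b + d c →
        v ((Matrix.det (∑ l, ((X : F[X]) ^ d l) • (S l).map (C : F →+* F[X]))).coeff E') * r ^ E'
          < v ((Matrix.det (∑ l, ((X : F[X]) ^ d l) • (S l).map (C : F →+* F[X]))).coeff (d b + d c)) * r ^ (d b + d c))
    (hlead_ae : v (S a 0 0 * S e 1 1 + S e 0 0 * S a 1 1 - 2 * S a 0 1 * S e 0 1)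
      = v ((Matrix.det (∑ l, ((X : F[X]) ^ d l) • (S l).map (C : F →+* F[X]))).coeff (d a + d e)))
    (hlead_bc : v (S b 0 0 * S c 1 1 + S c 0 0 * S b 1 1 - 2 * S b 0 1 * S c 0 1)
      = v ((Matrix.det (∑ l, ((X : F[X]) ^ d l) • (S l).map (C : F →+* F[X]))).coeff (d b + d c))) :
    False := by
  set f : F[X] := Matrix.det (∑ l, ((X : F[X]) ^ d l) • (S l).map (C : F →+* F[X])) with hf
  set Gm : Fin K → Fin K → F := fun i j => S i 0 0 * S j 1 1 + S j 0 0 * S i 1 1 - 2 * S i 0 1 * S j 0 1 with hGm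
  have hGsymm : ∀ i j, Gm i j = Gm j i := fun i j => by simp only [hGm]; ring
  have hlead_ae' : v (Gm a e) = v (f.coeff (d a + d e)) := hlead_ae
  have hlead_bc' : v (Gm b c) = v (f.coeff (d b + d c)) := hlead_bc
  set B : ℕ := d a + d e with hBdef
  set Cx : ℕ := d b + d c with hCdef
  have hda : d a < d b := hd hab
  have hdb : d b < d c := hd hbc
  have hdc : d c < d e := hd hce
  -- the two dominance lines and their roof
  set ℓ : ℕ → ℝ := fun E => Real.log (v (f.coeff E)) with hℓ
  obtain ⟨sB, hsB⟩ := (exists_dominant_iff_exists_slope v f hB.1).1 hB.2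
  obtain ⟨sC, hsC⟩ := (exists_dominant_iff_exists_slope v f hC.1).1 hC.2
  set p : ℝ := ℓ B + (B : ℝ) * sB with hp
  set q : ℝ := -sB with hq
  set p' : ℝ := ℓ Cx + (Cx : ℝ) * sC with hp'
  set q' : ℝ := -sC with hq'
  set h : ℝ → ℝ := fun t => min (p + q * t) (p' + q' * t) with hh
  have hmaj : ∀ E ∈ f.support, ℓ E ≤ h E := by
    intro E hE
    refine le_min ?_ ?_
    · by_cases hEB : E = B
      · rw [hEB]; simp only [hp, hq]; linarith
      · have := hsB E hE hEB; simp only [hp, hq]; linarith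
    · by_cases hEC : E = Cx
      · rw [hEC]; simp only [hp', hq']; linarith
      · have := hsC E hE hEC; simp only [hp', hq']; linarith
  have hmaj_lt : ∀ E ∈ f.support, E ≠ B → E ≠ Cx → ℓ E < h E := by
    intro E hE hEB hEC
    refine lt_min ?_ ?_
    · have := hsB E hE hEB; simp only [hp, hq]; linarith
    · have := hsC E hE hEC; simp only [hp', hq']; linarith
  have hhB : h B = ℓ B := le_antisymm ((min_le_left _ _).trans (by simp only [hp, hq]; linarith)) (hmaj B hB.1)
  have hhC : h Cx = ℓ Cx := le_antisymm ((min_le_right _ _).trans (by simp only [hp', hq']; linarith)) (hmaj Cx hC.1)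
  -- the two structural lemmas for this roof
  have hle0 : ∀ i j, Gm i j ≠ 0 → Real.log (v (Gm i j)) ≤ h ((d i + d j : ℕ) : ℝ) := fun i j hG =>
    log_polar_le_roof_of_tame v hv d hd S hS hT p q p' q' (fun E hE => hmaj E hE) i j hG
  have hbtw : ∀ i j, Gm i j ≠ 0 → Real.log (v (Gm i j)) = h ((d i + d j : ℕ) : ℝ) →
      (d i + d j = B ∨ d i + d j = Cx) ∨ (i ≠ j ∧ min B Cx < d i + d j ∧ d i + d j < max B Cx) := fun i j hG htie =>
    touching_polar_between_of_tame v hv d hd S hS hT p q p' q' B Cx (fun E hE => hmaj E hE)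
      (fun E hE h1 h2 => hmaj_lt E hE h1 h2) i j hG htie
  -- the four letters
  set ι : Fin 4 → Fin K := ![a, b, c, e] with hι
  have hι0 : ι 0 = a := rfl
  have hι1 : ι 1 = b := rfl
  have hι2 : ι 2 = c := rfl
  have hι3 : ι 3 = e := rfl
  have hmono : StrictMono (d ∘ ι) := by
    refine Fin.strictMono_iff_lt_succ.2 fun i => ?_
    fin_cases i
    · exact hda
    · exact hdb
    · exact hdc
  have e0 : ∀ h0 : 0 < 4, ι ⟨0, h0⟩ = a := fun _ => rfl
  have e1 : ∀ h0 : 1 < 4, ι ⟨1, h0⟩ = b := fun _ => rfl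
  have e2 : ∀ h0 : 2 < 4, ι ⟨2, h0⟩ = c := fun _ => rfl
  have e3 : ∀ h0 : 3 < 4, ι ⟨3, h0⟩ = e := fun _ => rfl
  -- cells of the quadruple: sum `B` only on the reversal or on a doubled middle letter, sum `Cx` only on the reversal, never between
  have hcell : ∀ i j : Fin 4, (d (ι i) + d (ι j) = B → i = Fin.revPerm j ∨ (i = j ∧ (i.val = 1 ∨ i.val = 2))) ∧
      (d (ι i) + d (ι j) = Cx → i = Fin.revPerm j) ∧
      (i ≠ j → ¬ (min B Cx < d (ι i) + d (ι j) ∧ d (ι i) + d (ι j) < max B Cx)) := by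
    intro i j
    suffices hs : (d (ι i) + d (ι j) = B → i.val + j.val = 3 ∨ (i.val = j.val ∧ (i.val = 1 ∨ i.val = 2))) ∧
        (d (ι i) + d (ι j) = Cx → i.val + j.val = 3) ∧
        (i.val ≠ j.val → ¬ (min B Cx < d (ι i) + d (ι j) ∧ d (ι i) + d (ι j) < max B Cx)) by
      refine ⟨fun h0 => ?_, fun h0 => Fin.ext ?_, fun hne => hs.2.2 fun h0 => hne (Fin.ext h0)⟩
      · rcases hs.1 h0 with h1 | ⟨h1, h2⟩
        · left; apply Fin.ext; rw [Fin.revPerm_apply, Fin.val_rev]; omega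
        · right; exact ⟨Fin.ext h1, h2⟩
      · rw [Fin.revPerm_apply, Fin.val_rev]; have := hs.2.1 h0; omega
    rcases i with ⟨iv, hiv⟩
    rcases j with ⟨jv, hjv⟩
    simp only [ne_eq]
    rcases le_total B Cx with hle | hle
    · rw [min_eq_left hle, max_eq_right hle]
      interval_cases iv <;> interval_cases jv <;> simp only [e0, e1, e2, e3] <;>
        refine ⟨fun h1 => ?_, fun h2 => ?_, fun h3 => ?_⟩ <;> first | trivial | omega
    · rw [min_eq_right hle, max_eq_left hle]
      interval_cases iv <;> interval_cases jv <;> simp only [e0, e1, e2, e3] <;>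
        refine ⟨fun h1 => ?_, fun h2 => ?_, fun h3 => ?_⟩ <;> first | trivial | omega
  have hrev_sum : ∀ l : Fin 4, d (ι (Fin.revPerm l)) + d (ι l) = B ∨ d (ι (Fin.revPerm l)) + d (ι l) = Cx := by
    intro l
    fin_cases l
    · left; show d (ι 3) + d (ι 0) = B; rw [hι3, hι0, hBdef, Nat.add_comm]
    · right; show d (ι 2) + d (ι 1) = Cx; rw [hι2, hι1, hCdef, Nat.add_comm]
    · right; show d (ι 1) + d (ι 2) = Cx; rw [hι1, hι2]
    · left; show d (ι 0) + d (ι 3) = B; rw [hι0, hι3]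
  -- the leading entries are nonzero and touch the roof
  have hGae : Gm a e ≠ 0 := fun h0 => by
    have : v (f.coeff B) = 0 := by rw [← hlead_ae', h0, map_zero]
    exact (Polynomial.mem_support_iff.1 hB.1) (v.eq_zero.1 this)
  have hGbc : Gm b c ≠ 0 := fun h0 => by
    have : v (f.coeff Cx) = 0 := by rw [← hlead_bc', h0, map_zero]
    exact (Polynomial.mem_support_iff.1 hC.1) (v.eq_zero.1 this)
  have hrev_cell : ∀ l : Fin 4, Gm (ι (Fin.revPerm l)) (ι l) ≠ 0 ∧
      Real.log (v (Gm (ι (Fin.revPerm l)) (ι l))) = h ((d (ι (Fin.revPerm l)) + d (ι l) : ℕ) : ℝ) := by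
    have kB : Real.log (v (Gm a e)) = h ((B : ℕ) : ℝ) := by rw [hlead_ae', hhB]
    have kC : Real.log (v (Gm b c)) = h ((Cx : ℕ) : ℝ) := by rw [hlead_bc', hhC]
    intro l
    fin_cases l
    · show Gm (ι 3) (ι 0) ≠ 0 ∧ Real.log (v (Gm (ι 3) (ι 0))) = h ((d (ι 3) + d (ι 0) : ℕ) : ℝ)
      rw [hι3, hι0, hGsymm e a, Nat.add_comm]; exact ⟨hGae, kB⟩
    · show Gm (ι 2) (ι 1) ≠ 0 ∧ Real.log (v (Gm (ι 2) (ι 1))) = h ((d (ι 2) + d (ι 1) : ℕ) : ℝ)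
      rw [hι2, hι1, hGsymm c b, Nat.add_comm]; exact ⟨hGbc, kC⟩
    · show Gm (ι 1) (ι 2) ≠ 0 ∧ Real.log (v (Gm (ι 1) (ι 2))) = h ((d (ι 1) + d (ι 2) : ℕ) : ℝ)
      rw [hι1, hι2]; exact ⟨hGbc, kC⟩
    · show Gm (ι 0) (ι 3) ≠ 0 ∧ Real.log (v (Gm (ι 0) (ι 3))) = h ((d (ι 0) + d (ι 3) : ℕ) : ℝ)
      rw [hι0, hι3]; exact ⟨hGae, kB⟩
  -- the Gram minor
  set G : Matrix (Fin 4) (Fin 4) F :=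
    Matrix.of fun i j : Fin 4 => S (ι i) 0 0 * S (ι j) 1 1 + S (ι j) 0 0 * S (ι i) 1 1 - 2 * S (ι i) 0 1 * S (ι j) 0 1 with hG
  have hdet : G.det = 0 := det_gram_polarDet_eq_zero (fun i => S (ι i) 0 0) (fun i => S (ι i) 0 1) (fun i => S (ι i) 1 1)
  have hGG : ∀ i j, G i j = Gm (ι i) (ι j) := fun i j => by rw [hG, Matrix.of_apply]
  have hterm : ∀ σ : Equiv.Perm (Fin 4), v (Equiv.Perm.sign σ • ∏ l, G (σ l) l) = ∏ l, v (G (σ l) l) := by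
    intro σ
    rcases Int.units_eq_one_or (Equiv.Perm.sign σ) with h1 | h1
    · rw [h1, one_smul, map_prod]
    · rw [h1, Units.neg_smul, one_smul, AbsoluteValue.map_neg, map_prod]
  set x : Fin 4 → Fin 4 → ℝ := fun i j => h ((d (ι i) + d (ι j) : ℕ) : ℝ) with hx
  have hxsymm : ∀ i j, x i j = x j i := fun i j => by simp only [hx, Nat.add_comm]
  have hconc : ∀ p₁ q₁ p₂ q₂ p₃ q₃ p₄ q₄ : Fin 4,
      (d ∘ ι) p₁ + (d ∘ ι) q₁ + ((d ∘ ι) p₄ + (d ∘ ι) q₄) = (d ∘ ι) p₂ + (d ∘ ι) q₂ + ((d ∘ ι) p₃ + (d ∘ ι) q₃) →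
      (d ∘ ι) p₁ + (d ∘ ι) q₁ < (d ∘ ι) p₂ + (d ∘ ι) q₂ → (d ∘ ι) p₁ + (d ∘ ι) q₁ < (d ∘ ι) p₃ + (d ∘ ι) q₃ →
      x p₁ q₁ + x p₄ q₄ ≤ x p₂ q₂ + x p₃ q₃ := by
    intro p₁ q₁ p₂ q₂ p₃ q₃ p₄ q₄ hsum h12 h13
    simp only [Function.comp_apply] at hsum h12 h13
    simp only [hx, hh]
    refine min_affine_outer_le_inner _ _ _ _ _ _ _ _ ?_ ?_ ?_
    · exact_mod_cast h12.le
    · exact_mod_cast h13.le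
    · exact_mod_cast hsum
  have heq : ∏ l, v (G (Fin.revPerm l) l) = Real.exp (∑ l : Fin 4, x (Fin.revPerm l) l) := by
    rw [Real.exp_sum]
    refine Finset.prod_congr rfl fun l _ => ?_
    rw [hGG, hx]
    simp only []
    rw [← (hrev_cell l).2, Real.exp_log (v.pos (hrev_cell l).1)]
  have hmax : ∀ σ ∈ (univ : Finset (Equiv.Perm (Fin 4))), σ ≠ Fin.revPerm →
      v (Equiv.Perm.sign σ • ∏ l, G (σ l) l)
        < v (Equiv.Perm.sign (Fin.revPerm : Equiv.Perm (Fin 4)) • ∏ l, G ((Fin.revPerm : Equiv.Perm (Fin 4)) l) l) := by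
    intro σ _ hσ
    rw [hterm, hterm, heq]
    by_cases hz : ∃ l, G (σ l) l = 0
    · obtain ⟨l, hl⟩ := hz
      rw [Finset.prod_eq_zero (Finset.mem_univ l) (by rw [hl, map_zero])]
      exact Real.exp_pos _
    push Not at hz
    have hz' : ∀ l, Gm (ι (σ l)) (ι l) ≠ 0 := fun l => by rw [← hGG]; exact hz l
    have hprod : ∏ l, v (G (σ l) l) = Real.exp (∑ l, Real.log (v (G (σ l) l))) := by
      rw [Real.exp_sum]
      exact Finset.prod_congr rfl fun l _ => (Real.exp_log (v.pos (hz l))).symm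
    rw [hprod]
    refine Real.exp_lt_exp.2 ?_
    have hle_l : ∀ l, Real.log (v (G (σ l) l)) ≤ x (σ l) l := fun l => by rw [hGG]; exact hle0 _ _ (hz' l)
    have hroof : ∑ l, x (σ l) l ≤ ∑ l, x (Fin.revPerm l) l := by
      calc ∑ l, x (σ l) l = ∑ l, x l (σ l) := Finset.sum_congr rfl fun l _ => hxsymm _ _
        _ ≤ ∑ l, x l (Fin.revPerm l) := sum_perm_le_sum_rev x (d ∘ ι) (d ∘ ι) hmono hmono hconc _ σ le_rfl
        _ = ∑ l, x (Fin.revPerm l) l := Finset.sum_congr rfl fun l _ => hxsymm _ _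
    by_cases hall : ∀ l, Real.log (v (G (σ l) l)) = x (σ l) l
    · -- all four cells touch the roof: each is a reversal cell or a doubled middle letter of class `B`; the latter is impossible
      exfalso
      have hfix : ∀ l, σ l = Fin.revPerm l ∨ (σ l = l ∧ (l.val = 1 ∨ l.val = 2) ∧ d (ι l) + d (ι l) = B) := by
        intro l
        have htie : Real.log (v (Gm (ι (σ l)) (ι l))) = h ((d (ι (σ l)) + d (ι l) : ℕ) : ℝ) := by rw [← hGG]; exact hall l
        obtain ⟨h1, h2, h3⟩ := hcell (σ l) l
        rcases hbtw (ι (σ l)) (ι l) (hz' l) htie with (hb | hc') | ⟨hne, hbt⟩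
        · rcases h1 hb with h4 | ⟨h4, h5⟩
          · exact Or.inl h4
          · right
            refine ⟨h4, by rw [← h4]; exact h5, ?_⟩
            rw [h4] at hb; exact hb
        · exact Or.inl (h2 hc')
        · exact absurd hbt (h3 fun h0 => hne (by rw [h0]))
      apply hσ
      refine Equiv.ext fun l => ?_
      rcases hfix l with h0 | ⟨h0, h12, hdbl⟩
      · exact h0
      · exfalso
        -- the other middle letter must then be doubled of class `B` as well
        have hval : ∀ l' : Fin 4, (l'.val = 1 ∨ l'.val = 2) → l' ≠ l → σ l' = l' ∧ d (ι l') + d (ι l') = B := by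
          intro l' h12' hne'
          rcases hfix l' with h0' | ⟨h0', -, hdbl'⟩
          · exfalso
            have hrl : Fin.revPerm l' = l := by
              apply Fin.ext; rw [Fin.revPerm_apply, Fin.val_rev]
              have := Fin.val_ne_of_ne hne'
              omega
            rw [hrl] at h0'
            exact hne' (σ.injective (h0'.trans h0.symm))
          · exact ⟨h0', hdbl'⟩
        have e0' : ∀ l₀ : Fin 4, l₀.val = 1 → d (ι l₀) = d b := by
          intro l₀ hl; rcases l₀ with ⟨lv, hlv⟩; simp only at hl; subst hl; rfl
        have e0'' : ∀ l₀ : Fin 4, l₀.val = 2 → d (ι l₀) = d c := by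
          intro l₀ hl; rcases l₀ with ⟨lv, hlv⟩; simp only at hl; subst hl; rfl
        rcases h12 with hl1 | hl2
        · obtain ⟨-, hdbl'⟩ := hval ⟨2, by omega⟩ (Or.inr rfl) (fun h' => by rw [← h'] at hl1; simp at hl1)
          rw [e0' l hl1] at hdbl; rw [e0'' ⟨2, by omega⟩ rfl] at hdbl'; omega
        · obtain ⟨-, hdbl'⟩ := hval ⟨1, by omega⟩ (Or.inl rfl) (fun h' => by rw [← h'] at hl2; simp at hl2)
          rw [e0'' l hl2] at hdbl; rw [e0' ⟨1, by omega⟩ rfl] at hdbl'; omega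
    · push Not at hall
      obtain ⟨l₀, hl₀⟩ := hall
      have hlt_l : Real.log (v (G (σ l₀) l₀)) < x (σ l₀) l₀ := lt_of_le_of_ne (hle_l l₀) hl₀
      calc ∑ l, Real.log (v (G (σ l) l)) < ∑ l, x (σ l) l :=
            Finset.sum_lt_sum (fun l _ => hle_l l) ⟨l₀, Finset.mem_univ _, hlt_l⟩
        _ ≤ ∑ l, x (Fin.revPerm l) l := hroof
  have hsum := abv_sum_eq_of_unique_max v hv (univ : Finset (Equiv.Perm (Fin 4)))
    (fun σ => Equiv.Perm.sign σ • ∏ l, G (σ l) l) (Finset.mem_univ (Fin.revPerm : Equiv.Perm (Fin 4))) hmax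
  rw [← Matrix.det_apply, hdet, map_zero, hterm, heq] at hsum
  exact absurd hsum (ne_of_lt (Real.exp_pos _))

end Summit.ValiantsHypothesis.ValiantsHypothesis.Theorems.KPlusLogSqLaw.ValDoor
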